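import Summits.NavierStokesRegularity.NavierStokesRegularity.Theorems.RellichScarSymmetricScarExistsRotInvariantLimit

/-!
# Crux `SymmetricScarExists` (stmt-NavierStokesRegularity-11718), line `rdss-screw-split` — stub
# `stub_screwInvariantLimitMoving` (AUX-10): screw invariance with factors `c_j → 1` and MOVING angles
# `θ_j → θ₀` becomes rotation invariance by `θ₀` of the `L³_loc` limit

Helper file of the line lead (`--supports stmt-NavierStokesRegularity-11718`; theorems only, no definitions,
no named facts), pure real analysis; the moving-angle version of AUX-3 (`stub_rotInvariantLimit`).
Let `V_j → u` in `L³(Q(0,R))` for every `R > 0` (`Q(0,R) = ]-R², 0[ × B(0,R)` = `parabolicCylinder R 0`),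
let every `V_j` be a.e. fixed on the slab `(-∞, 0) × ℝ³` by the screw `w ↦ R_{θ_j} D_{c_j} w ∘ R_{−θ_j}`
(`(D_c w)(t, x) = c w(c² t, c x)` = `nsRescale c w`, `R_θ = rotZ θ` the rotation about `e₃`), with `c_j > 0`,
`c_j → 1`, let the dilations `D_{c_j} u → u` in every `L³(Q(0,R))` (AUX-2) and let the rotated conjugates
`R_{θ_j} u ∘ R_{−θ_j} → R_{θ₀} u ∘ R_{−θ₀}` in every `L³(Q(0,R))` (AUX-9, rotation continuity of `u` along
`θ_j → θ₀`).  Then `R_{θ₀} u(t, R_{−θ₀} x) = u(t, x)` a.e. on the slab (`stub_screwInvariantLimitMoving`).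

Proof (`screwLimitMoving_ae_ball`).  On each ball `Q(0,R)`, for `j` so large that `e^{-1} ≤ c_j ≤ e`, five terms:
`‖R_{θ₀} u∘R_{−θ₀} − u‖ ≤ ‖R_{θ₀} u∘R_{−θ₀} − R_{θ_j} u∘R_{−θ_j}‖ + ‖R_{θ_j} u∘R_{−θ_j} − R_{θ_j} D_{c_j}u∘R_{−θ_j}‖
+ ‖R_{θ_j} D_{c_j}u∘R_{−θ_j} − V_j‖ + ‖V_j − u‖`; the first is the new hypothesis, the second is
`‖u − D_{c_j}u‖_{L³(Q(0,R))}` (the rotated conjugation by ANY angle is an isometry of `L³(Q(0,R))`,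
`rlRotAbs_eLpNorm_conj`), the third is `‖R_{θ_j} D_{c_j}u∘R_{−θ_j} − R_{θ_j} D_{c_j}V_j∘R_{−θ_j}‖
= c_j (c_j⁵)^{-1/3} ‖u − V_j‖_{L³(Q(0,c_j R))}` (a.e. `V_j = R_{θ_j} D_{c_j}V_j∘R_{−θ_j}` on the ball, then the
exact scaling law `Robust.eLpNorm_screw_sub_screw`, valid for every angle with the same constant; the constant
is bounded on `[e^{-1}, e]`, `rlRotAbs_zoomConst_le`, and `Q(0, c_j R) ⊆ Q(0, eR)`), so all terms tend to
`0`; finally the balls `Q(0, n+1)` exhaust the slab.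

## References

* D. Chae, J. Wolf, arXiv:1610.09464 (2017), Thm 1.3 (the same passage to the limit in a screw defect).
  [ChaeWolf2017RemovingDSS]
* W. Rudin, *Real and Complex Analysis*, 3rd ed., Thm. 3.12 (vanishing `L^p` norm ⇒ a.e. zero). [folklore]
-/

noncomputable section

open MeasureTheory Set Function Filter Topology TopologicalSpace Metric
open scoped NNReal ENNReal

namespace Summit.NavierStokesRegularity.NavierStokesRegularity.Theorems.SymmetricScarExists.RdssSplit.NearIdentity

set_option linter.dupNamespace false

open Literature.Analysis.FluidPDE

/-- **The rotation defect by the limit angle `θ₀` of an `L³_loc` limit of `(c_j, θ_j)`-screw-invariant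
fields vanishes on every ball** when `c_j → 1`, the dilations `D_{c_j} u → u` and the rotated conjugates
`R_{θ_j} u∘R_{−θ_j} → R_{θ₀} u∘R_{−θ₀}` in `L³(Q(0,R))`: four-term splitting
`‖R_{θ₀} u∘R_{−θ₀} − u‖ ≤ ‖R_{θ_j} u∘R_{−θ_j} − R_{θ₀} u∘R_{−θ₀}‖ + ‖u − D_{c_j}u‖
+ c_j(c_j⁵)^{-1/3} ‖u − V_j‖_{Q(0,c_jR)} + ‖V_j − u‖` on the tail `e^{-1} ≤ c_j ≤ e`, every term tending
to `0`. [folklore] -/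
theorem screwLimitMoving_ae_ball {θ : ℕ → ℝ} {θ₀ : ℝ} {c : ℕ → ℝ}
    {V : ℕ → ℝ → EuclideanSpace ℝ (Fin 3) → EuclideanSpace ℝ (Fin 3)}
    {u : ℝ → EuclideanSpace ℝ (Fin 3) → EuclideanSpace ℝ (Fin 3)}
    (hc0 : ∀ j, 0 < c j) (hc1 : Tendsto c atTop (𝓝 1))
    (hVm : ∀ (j : ℕ) (r : ℝ), 0 < r → ∀ R : ℝ, 0 < R → AEStronglyMeasurable (uncurry (nsRescale r (V j)))
      (volume.restrict (parabolicCylinder R (0 : ℝ × EuclideanSpace ℝ (Fin 3)))))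
    (hum : ∀ (r : ℝ), 0 < r → ∀ R : ℝ, 0 < R → AEStronglyMeasurable (uncurry (nsRescale r u))
      (volume.restrict (parabolicCylinder R (0 : ℝ × EuclideanSpace ℝ (Fin 3)))))
    (hconv : ∀ R : ℝ, 0 < R → Tendsto (fun j => eLpNorm (uncurry (V j) - uncurry u) 3
      (volume.restrict (parabolicCylinder R (0 : ℝ × EuclideanSpace ℝ (Fin 3))))) atTop (𝓝 0))
    (hdil : ∀ R : ℝ, 0 < R → Tendsto (fun j => eLpNorm (uncurry (nsRescale (c j) u) - uncurry u) 3
      (volume.restrict (parabolicCylinder R (0 : ℝ × EuclideanSpace ℝ (Fin 3))))) atTop (𝓝 0))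
    (hrot : ∀ R : ℝ, 0 < R → Tendsto (fun j => eLpNorm
      (uncurry (fun t x => rotZ (θ j) (u t (rotZ (-(θ j)) x))) -
        uncurry (fun t x => rotZ θ₀ (u t (rotZ (-θ₀) x)))) 3
      (volume.restrict (parabolicCylinder R (0 : ℝ × EuclideanSpace ℝ (Fin 3))))) atTop (𝓝 0))
    (hfix : ∀ j, uncurry (fun t x => rotZ (θ j) (nsRescale (c j) (V j) t (rotZ (-(θ j)) x)))
      =ᵐ[volume.restrict (Iio (0 : ℝ) ×ˢ (univ : Set (EuclideanSpace ℝ (Fin 3))))] uncurry (V j))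
    {R : ℝ} (hR : 0 < R) :
    ∀ᵐ z ∂(volume.restrict (parabolicCylinder R (0 : ℝ × EuclideanSpace ℝ (Fin 3)))),
      uncurry (fun t x => rotZ θ₀ (u t (rotZ (-θ₀) x))) z = uncurry u z := by
  have h13 : (1 : ℝ≥0∞) ≤ 3 := by norm_num
  -- unscaled measurability
  have hum1 : ∀ R : ℝ, 0 < R → AEStronglyMeasurable (uncurry u)
      (volume.restrict (parabolicCylinder R (0 : ℝ × EuclideanSpace ℝ (Fin 3)))) := by
    intro R hR
    have h := hum 1 one_pos R hR
    rwa [nsRescale_one] at h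
  have hVm1 : ∀ (j : ℕ) (R : ℝ), 0 < R → AEStronglyMeasurable (uncurry (V j))
      (volume.restrict (parabolicCylinder R (0 : ℝ × EuclideanSpace ℝ (Fin 3)))) := by
    intro j R hR
    have h := hVm j 1 one_pos R hR
    rwa [nsRescale_one] at h
  set μR : Measure (ℝ × EuclideanSpace ℝ (Fin 3)) :=
    volume.restrict (parabolicCylinder R (0 : ℝ × EuclideanSpace ℝ (Fin 3))) with hμR
  -- the players: the `θ₀`-conjugate of `u`, the `θ_j`-conjugates of `u`, `D_{c_j} u`, `D_{c_j} V_j`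
  set Su : ℝ × EuclideanSpace ℝ (Fin 3) → EuclideanSpace ℝ (Fin 3) :=
    uncurry (fun t x => rotZ θ₀ (u t (rotZ (-θ₀) x)))
  set Sju : ℕ → ℝ × EuclideanSpace ℝ (Fin 3) → EuclideanSpace ℝ (Fin 3) :=
    fun j => uncurry (fun t x => rotZ (θ j) (u t (rotZ (-(θ j)) x))) with hSju
  set SDu : ℕ → ℝ × EuclideanSpace ℝ (Fin 3) → EuclideanSpace ℝ (Fin 3) :=
    fun j => uncurry (fun t x => rotZ (θ j) (nsRescale (c j) u t (rotZ (-(θ j)) x))) with hSDu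
  set SV : ℕ → ℝ × EuclideanSpace ℝ (Fin 3) → EuclideanSpace ℝ (Fin 3) :=
    fun j => uncurry (fun t x => rotZ (θ j) (nsRescale (c j) (V j) t (rotZ (-(θ j)) x))) with hSV
  have hSum : AEStronglyMeasurable Su μR :=
    rlRotAbs_aesm_conj θ₀ R (g := uncurry u) (hum1 R hR)
  have hSjum : ∀ j, AEStronglyMeasurable (Sju j) μR := fun j =>
    rlRotAbs_aesm_conj (θ j) R (g := uncurry u) (hum1 R hR)
  have hSDum : ∀ j, AEStronglyMeasurable (SDu j) μR := fun j =>
    rlRotAbs_aesm_conj (θ j) R (g := uncurry (nsRescale (c j) u)) (hum (c j) (hc0 j) R hR)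
  have hUm : AEStronglyMeasurable (uncurry u) μR := hum1 R hR
  have hVjm : ∀ j, AEStronglyMeasurable (uncurry (V j)) μR := fun j => hVm1 j R hR
  -- the screw invariance of `V_j`, restricted to the ball
  have hfixR : ∀ j, SV j =ᵐ[μR] uncurry (V j) := fun j =>
    ae_restrict_of_ae_restrict_of_subset (parabolicCylinder_origin_subset_slab R) (hfix j)
  -- the bound on the scaling constants on the tail `e^{-1} ≤ c_j ≤ e`
  set K : ℝ≥0∞ := ENNReal.ofReal (Real.exp 1) *
    (ENNReal.ofReal (Real.exp (-1) ^ 2 * Real.exp (-1) ^ 3)⁻¹) ^ (1 / (3 : ℝ≥0∞).toReal)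
  have hKtop : K ≠ ⊤ := ENNReal.mul_ne_top ENNReal.ofReal_ne_top
    (ENNReal.rpow_ne_top_of_nonneg (by norm_num) ENNReal.ofReal_ne_top)
  have heR : (0 : ℝ) < Real.exp 1 * R := by positivity
  have htail : ∀ᶠ j in atTop, Real.exp (-1) ≤ c j ∧ c j ≤ Real.exp 1 :=
    hc1.eventually_mem (Icc_mem_nhds (Real.exp_lt_one_iff.2 (by norm_num))
      (Real.one_lt_exp_iff.2 one_pos))
  -- the four-term bound on the tail
  have hev : ∀ᶠ j in atTop, eLpNorm (Su - uncurry u) 3 μR ≤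
      eLpNorm (Sju j - Su) 3 μR +
        (eLpNorm (uncurry (nsRescale (c j) u) - uncurry u) 3 μR +
          (K * eLpNorm (uncurry (V j) - uncurry u) 3
              (volume.restrict (parabolicCylinder (Real.exp 1 * R) (0 : ℝ × EuclideanSpace ℝ (Fin 3)))) +
            eLpNorm (uncurry (V j) - uncurry u) 3 μR)) := by
    filter_upwards [htail] with j hj
    have e : Su - uncurry u =
        (Su - Sju j) + ((Sju j - SDu j) + ((SDu j - uncurry (V j)) + (uncurry (V j) - uncurry u))) := by
      rw [sub_add_sub_cancel, sub_add_sub_cancel, sub_add_sub_cancel]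
    -- first term: the new hypothesis, up to the order of the difference
    have hA0 : eLpNorm (Su - Sju j) 3 μR = eLpNorm (Sju j - Su) 3 μR := eLpNorm_sub_comm _ _ _ _
    -- second term: the rotated conjugation by `θ_j` is an isometry of `L³(Q(0,R))`
    have hA : eLpNorm (Sju j - SDu j) 3 μR = eLpNorm (uncurry (nsRescale (c j) u) - uncurry u) 3 μR := by
      have e1 : Sju j - SDu j = fun z : ℝ × EuclideanSpace ℝ (Fin 3) =>
          rotZ (θ j) (uncurry u (z.1, rotZ (-(θ j)) z.2)) -
            rotZ (θ j) (uncurry (nsRescale (c j) u) (z.1, rotZ (-(θ j)) z.2)) := rfl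
      rw [e1, hμR, rlRotAbs_eLpNorm_conj (θ j) R (hum1 R hR) (hum (c j) (hc0 j) R hR), eLpNorm_sub_comm]
    -- third term: a.e. `V_j` is its own screw image, then the exact scaling law
    have hB : eLpNorm (SDu j - uncurry (V j)) 3 μR ≤
        K * eLpNorm (uncurry (V j) - uncurry u) 3
          (volume.restrict (parabolicCylinder (Real.exp 1 * R) (0 : ℝ × EuclideanSpace ℝ (Fin 3)))) := by
      have e2 : eLpNorm (SDu j - uncurry (V j)) 3 μR = eLpNorm (SDu j - SV j) 3 μR := by
        refine eLpNorm_congr_ae ?_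
        filter_upwards [hfixR j] with z hz
        rw [Pi.sub_apply, Pi.sub_apply, hz]
      rw [e2, hSDu, hSV, hμR, Robust.eLpNorm_screw_sub_screw (hc0 j) (θ j) R (hum (c j) (hc0 j) R hR)
        (hVm j (c j) (hc0 j) R hR), eLpNorm_sub_comm]
      refine mul_le_mul' (rlRotAbs_zoomConst_le hj.1 hj.2) ?_
      exact eLpNorm_mono_measure _ (Measure.restrict_mono
        (SuitableCompactness.parabolicCylinder_zero_mono (mul_nonneg (hc0 j).le hR.le)
          (mul_le_mul_of_nonneg_right hj.2 hR.le)) le_rfl)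
    calc eLpNorm (Su - uncurry u) 3 μR
        ≤ eLpNorm (Su - Sju j) 3 μR +
            eLpNorm ((Sju j - SDu j) + ((SDu j - uncurry (V j)) + (uncurry (V j) - uncurry u))) 3 μR := by
          rw [e]
          exact eLpNorm_add_le (hSum.sub (hSjum j))
            (((hSjum j).sub (hSDum j)).add (((hSDum j).sub (hVjm j)).add ((hVjm j).sub hUm))) h13
      _ ≤ eLpNorm (Su - Sju j) 3 μR + (eLpNorm (Sju j - SDu j) 3 μR +
            eLpNorm ((SDu j - uncurry (V j)) + (uncurry (V j) - uncurry u)) 3 μR) :=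
          add_le_add le_rfl
            (eLpNorm_add_le ((hSjum j).sub (hSDum j)) (((hSDum j).sub (hVjm j)).add ((hVjm j).sub hUm)) h13)
      _ ≤ eLpNorm (Su - Sju j) 3 μR + (eLpNorm (Sju j - SDu j) 3 μR +
            (eLpNorm (SDu j - uncurry (V j)) 3 μR + eLpNorm (uncurry (V j) - uncurry u) 3 μR)) :=
          add_le_add le_rfl (add_le_add le_rfl
            (eLpNorm_add_le ((hSDum j).sub (hVjm j)) ((hVjm j).sub hUm) h13))
      _ ≤ _ := by
          rw [hA0, hA]
          exact add_le_add le_rfl (add_le_add le_rfl (add_le_add hB le_rfl))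
  -- the four terms tend to zero
  have hBlim : Tendsto (fun j => K * eLpNorm (uncurry (V j) - uncurry u) 3
      (volume.restrict (parabolicCylinder (Real.exp 1 * R) (0 : ℝ × EuclideanSpace ℝ (Fin 3)))))
      atTop (𝓝 0) := by
    have h := ENNReal.Tendsto.const_mul (hconv (Real.exp 1 * R) heR) (Or.inr hKtop) (a := K)
    rwa [mul_zero] at h
  have hlim := (hrot R hR).add ((hdil R hR).add (hBlim.add (hconv R hR)))
  simp only [add_zero] at hlim
  have h0 : eLpNorm (Su - uncurry u) 3 μR = 0 := le_antisymm (ge_of_tendsto hlim hev) zero_le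
  rw [eLpNorm_eq_zero_iff (hSum.sub hUm) (by norm_num)] at h0
  filter_upwards [h0] with z hz
  rw [Pi.sub_apply, Pi.zero_apply, sub_eq_zero] at hz
  exact hz

/-- AUX-10 `stub_screwInvariantLimitMoving` — **screw invariance with factors `c_j → 1` and moving angles
`θ_j → θ₀` becomes rotation invariance by `θ₀` in the `L³_loc` limit**: if `V_j → u` in every `L³(Q(0,R))`,
each `V_j` is a.e. fixed on the slab by the screw `(c_j, θ_j)`, `c_j → 1`, `θ_j → θ₀`, the dilations
`D_{c_j} u → u` and the rotated conjugates `R_{θ_j} u∘R_{−θ_j} → R_{θ₀} u∘R_{−θ₀}` in every `L³(Q(0,R))`,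
then `R_{θ₀} u(t, R_{−θ₀} x) = u(t, x)` a.e. on the slab (`screwLimitMoving_ae_ball` on every ball, then
exhaustion of the slab by the balls `Q(0, n+1)`). [folklore] -/
theorem stub_screwInvariantLimitMoving : ∀ (θ : ℕ → ℝ) (θ₀ : ℝ) (c : ℕ → ℝ) (V : ℕ → ℝ → EuclideanSpace ℝ (Fin 3) → EuclideanSpace ℝ (Fin 3)) (u : ℝ → EuclideanSpace ℝ (Fin 3) → EuclideanSpace ℝ (Fin 3)), (∀ j : ℕ, 0 < c j) → Filter.Tendsto c Filter.atTop (nhds 1) → Filter.Tendsto θ Filter.atTop (nhds θ₀) → (∀ (j : ℕ) (r : ℝ), 0 < r → ∀ R : ℝ, 0 < R → MeasureTheory.AEStronglyMeasurable (Function.uncurry (Literature.Analysis.FluidPDE.nsRescale r (V j))) (MeasureTheory.volume.restrict (Literature.Analysis.FluidPDE.parabolicCylinder R (0 : ℝ × EuclideanSpace ℝ (Fin 3))))) → (∀ (r : ℝ), 0 < r → ∀ R : ℝ, 0 < R → MeasureTheory.AEStronglyMeasurable (Function.uncurry (Literature.Analysis.FluidPDE.nsRescale r u)) (MeasureTheory.volume.restrict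 (Literature.Analysis.FluidPDE.parabolicCylinder R (0 : ℝ × EuclideanSpace ℝ (Fin 3))))) → (∀ R : ℝ, 0 < R → Filter.Tendsto (fun j : ℕ => MeasureTheory.eLpNorm (Function.uncurry (V j) - Function.uncurry u) 3 (MeasureTheory.volume.restrict (Literature.Analysis.FluidPDE.parabolicCylinder R (0 : ℝ × EuclideanSpace ℝ (Fin 3))))) Filter.atTop (nhds 0)) → (∀ R : ℝ, 0 < R → Filter.Tendsto (fun j : ℕ => MeasureTheory.eLpNorm (Function.uncurry (Literature.Analysis.FluidPDE.nsRescale (c j) u) - Function.uncurry u) 3 (MeasureTheory.volume.restrict (Literature.Analysis.FluidPDE.parabolicCylinder R (0 : ℝ × EuclideanSpace ℝ (Fin 3))))) Filter.atTop (nhds 0)) → (∀ R : ℝ, 0 < R → Filter.Tendsto (fun j : ℕ => MeasureTheory.eLpNorm (Function.uncurry (fun t x => Literature.Analysis.FluidPDE.rotZ (θ j) (u t (Literature.Analysis.FluidPDE.rotZ (-(θ j)) x))) - Function.uncurry (fun t x => Literature.Analysis.FluidPDE.rotZ θ₀ (u t (Literature.Analysis.FluidPDE.rotZ (-θ₀)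 x)))) 3 (MeasureTheory.volume.restrict (Literature.Analysis.FluidPDE.parabolicCylinder R (0 : ℝ × EuclideanSpace ℝ (Fin 3))))) Filter.atTop (nhds 0)) → (∀ j : ℕ, Function.uncurry (fun t x => Literature.Analysis.FluidPDE.rotZ (θ j) (Literature.Analysis.FluidPDE.nsRescale (c j) (V j) t (Literature.Analysis.FluidPDE.rotZ (-(θ j)) x))) =ᵐ[MeasureTheory.volume.restrict (Set.Iio (0 : ℝ) ×ˢ Set.univ)] Function.uncurry (V j)) → Function.uncurry (fun t x => Literature.Analysis.FluidPDE.rotZ θ₀ (u t (Literature.Analysis.FluidPDE.rotZ (-θ₀) x))) =ᵐ[MeasureTheory.volume.restrict (Set.Iio (0 : ℝ) ×ˢ Set.univ)] Function.uncurry u := by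
  intro θ θ₀ c V u hc0 hc1 _hθ hVm hum hconv hdil hrot hfix
  -- exhaustion of the slab by the balls `Q(0, n+1)`
  refine ae_restrict_of_ae_restrict_of_subset
    Summit.NavierStokesRegularity.NavierStokesRegularity.Theorems.lowerHalf_subset_iUnion_parabolicCylinder ?_
  rw [ae_restrict_iUnion_iff]
  intro n
  exact screwLimitMoving_ae_ball hc0 hc1 hVm hum hconv hdil hrot hfix (R := (n : ℝ) + 1) (by positivity)

end Summit.NavierStokesRegularity.NavierStokesRegularity.Theorems.SymmetricScarExists.RdssSplit.NearIdentity

end
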